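import Literature.Geometry.Riemannian.AubinYamabeSphere
import Literature.Geometry.Riemannian.ChangGurskyYangProofs
import Literature.Geometry.Riemannian.RoundSphereVolume
import HarnessLib

/-!
# `Y(S⁴,[g_S]) ≥ 8√6 π` from the sharp Sobolev inequality on the round `S⁴` (proof file)

Proof file for the named fact `yamabe_roundMetric_sphere_four` of `AubinYamabeSphere.lean`
(Aubin 1982, Thm. 6.12: "For the sphere `S_n`, (`n ≥ 3`), `μ = n(n−1)ω_n^{2/n}`", metric form,
`n = 4`: for every `C^∞` metric `h` conformal to the round metric of the unit `S⁴ ⊂ ℝ⁵`,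
`8√6 π · √Vol(S⁴,h) ≤ ∫ R_h dV_h`).

Aubin's Thm. 6.12 has two halves: the FUNCTION FORM (loc. cit., (11)): on the round sphere every
`φ ∈ H₁` satisfies the Sobolev inequality with the best constant `K(n,2)` and second constant `1`
(volume normalised to `1`) — equivalently `J(φ) ≥ n(n−1)ω_n^{2/n}` for Yamabe's functional
`J(φ) = [4(n−1)/(n−2) ∫|∇φ|² dV + ∫ Rφ² dV] ‖φ‖_N^{−2}` of §6.4 (2) — and the identification
`J(φ) = Q(φ^{4/(n−2)} g)` of the functional with the Yamabe quotient of the conformal metric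
(§6.3, eq. (1) and Prop. 6.4: `dV' = φ^N dV`, `4((n−1)/(n−2))Δφ + Rφ = R'φ^{(n+2)/(n−2)}`), which
turns the function form into the metric form. In dimension `n = 4` (`N = 4`, `φ^{4/(n−2)} = φ²`,
`4(n−1)/(n−2) = 6`, `R_{S⁴} = 12`, `ω₄ = 8π²/3`, `12 ω₄^{1/2} = 8√6 π`) the function form reads,
for the unnormalised round measure `dV` of the unit `S⁴`,

  `8√6 π (∫_{S⁴} ψ⁴ dV)^{1/2} ≤ 12 ∫_{S⁴} ψ² dV + 6 ∫_{S⁴} |dψ|² dV`     (⋆)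

(Aubin 1976; Aubin 1982, Thm. 6.12 (11); Beckner 1993, Thm. 4 with `p = 4`, `n = 4`:
`‖f‖²_{L⁴(dσ)} ≤ ‖f‖²_{L²(dσ)} + ½ ‖∇f‖²_{L²(dσ)}` for the normalised measure `σ = dV/ω₄`).

THIS FILE PROVES THE SECOND HALF, i.e. the passage function form ⇒ metric form, entirely inside
the tree: `yamabe_roundMetric_sphere_four_of_sharpSobolev` — **(⋆) for all smooth positive `ψ`
on `S⁴` implies `yamabe_roundMetric_sphere_four`** — together with its converse
`sharpSobolev_of_yamabe_roundMetric_sphere_four` (apply the fact to `h = ψ² g_S`), whence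
`yamabe_roundMetric_sphere_four_iff_sharpSobolev`: THE NAMED FACT IS EQUIVALENT TO (⋆) FOR SMOOTH
POSITIVE FUNCTIONS (Aubin 1982, Thm. 6.12 iii)). Ingredients (all proved in the tree):
a metric `h` conformal to the round metric `g_S` is `ψ² g_S` with `ψ = √φ` smooth
(`contMDiff_conformalFactor_one`, `ConformalChangeFour.lean`); the conformal laws
`∫ R_h dV_h = ∫ R_{g_S} ψ² dV + 6 ∫ g_S⁻¹(dψ,dψ) dV` and `Vol(S⁴,h) = ∫ ψ⁴ dV`
(`totalScalarCurvature_conformal_sq`, `YamabePositivity.lean`, from Aubin's eq. (1) at `n = 4`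
and Green's identity); `R_{g_S} = 12` (`scalarCurvature_roundMetric`, `ChangGurskyYangProofs.lean`,
from the Gauss equation `curvature_roundMetric`); and the identification of any metric `g₀` with
`g₀(v,w) = ⟪dι v, dι w⟫` with `roundMetric` (`roundMetric_apply`, `RoundSphere.lean`).

THE BOUND IS ATTAINED (Aubin 1982, Thm. 6.12: `μ` is the VALUE `n(n−1)ω_n^{2/n}`, i.e. `J(1)`):
with `Vol(S⁴, g_S) = ω₄ = 8π²/3` (`riemannianMeasure_roundMetric_sphere_four_univ`,
`RoundSphereVolume.lean`) and `R_{g_S} = 12`, `totalScalarCurvature_roundMetric_sphere_four`: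
`∫ R_{g_S} dV = 32π²`, `yamabeQuotient_roundMetric_sphere_four`: `Q(g_S) = 32π²/(8π²/3)^{1/2}
= 8√6 π` — so the constant `8√6 π` of the fact cannot be improved — and, GIVEN the fact,
`yamabeConstant_roundMetric_sphere_four`: **`Y(S⁴,[g_S]) = 8√6 π`** (`≈ 61.56`), the
normalisation used by Chang–Gursky–Yang 2003 and Li–Qing–Shi 2017.

What is NOT here: the sharp Sobolev inequality (⋆) itself (Aubin 1976 / Talenti 1976 on `ℝⁿ` by
symmetrisation, Aubin 1982 Thm. 2.14 and Thm. 6.12; Beckner 1993 by spherical harmonics and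
Lieb's sharp Hardy–Littlewood–Sobolev inequality) — the analytic core of the fact, for which the
tree has no infrastructure yet (no rearrangements, coarea or isoperimetry, no optimal transport,
no spherical-harmonic `L²` decomposition, no heat semigroup on closed manifolds); it enters as the
hypothesis `hS`, stated verbatim as (⋆). No definitions, no named facts.

## References

* T. Aubin, *Nonlinear Analysis on Manifolds. Monge–Ampère Equations*, Grundlehren 252,
  Springer 1982, Ch. 6: §6.3 eq. (1), §6.4 (2) and Prop. 6.4, Thm. 6.12 and its (11). [Aubin1982]
* T. Aubin, *Problèmes isopérimétriques et espaces de Sobolev*, J. Diff. Geom. 11 (1976)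
  573–598 (= Aubin [13] of the book, p. 588). [Aubin1976]
* W. Beckner, *Sharp Sobolev inequalities on the sphere and the Moser–Trudinger inequality*,
  Ann. of Math. 138 (1993) 213–242, Thm. 4 (`‖F‖²_{L^q(Sⁿ)} ≤ (q−2)/n ‖∇F‖²₂ + ‖F‖²₂`,
  normalised measure). [Beckner1993]
* J. M. Lee, T. H. Parker, *The Yamabe problem*, Bull. AMS 17 (1987) 37–91, §3, Thm. 3.3
  (`λ(Sⁿ) = n(n−1)ω_n^{2/n}`, sharp Sobolev on the sphere). [LeeParker1987]
-/

noncomputable section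

open Bundle MeasureTheory Set Metric Module
open scoped Manifold ContDiff Topology ENNReal RealInnerProductSpace
-- Mathlib's scoped instance `Fact (finrank ℝ (EuclideanSpace ℝ (Fin n)) = n)`, feeding the
-- `[Fact (finrank ℝ V = n + 1)]` hypothesis of `roundMetric`
open scoped EuclideanSpace

namespace Literature.Geometry.Riemannian

open Literature.Geometry.Lorentzian (PseudoRiemannianMetric riemannianMeasure)
open Literature.Geometry.Lorentzian.PseudoRiemannianMetric
open Literature.Geometry.Lorentzian

/-- **Aubin's Theorem 6.12 for `S⁴`, metric form, from its function form.** Assume the sharp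
Sobolev inequality on the round unit `4`-sphere in the form (⋆): for every smooth positive `ψ`
on `S⁴`, `8√6 π (∫ ψ⁴ dV)^{1/2} ≤ 12 ∫ ψ² dV + 6 ∫ g_S⁻¹(dψ, dψ) dV`, `dV` the Riemannian measure
of the round metric `g_S = roundMetric` (Aubin 1982, Thm. 6.12 (11) at `n = 4`, unnormalised:
`12 ω₄^{1/2} = 8√6 π`; Beckner 1993, Thm. 4). Then `yamabe_roundMetric_sphere_four` holds: for
every smooth metric `g₀` on `S⁴` with `g₀(v,w) = ⟪dι v, dι w⟫` and every smooth `h` conformal to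
`g₀`, `8√6 π √Vol(S⁴,h) ≤ ∫ R_h dV_h`. Proof as printed (Aubin 1982, §6.3 eq. (1), Prop. 6.4,
`n = 4`): `h = φ g₀ = ψ² g_S` with `ψ = √φ` smooth and positive, `∫ R_h dV_h = ∫ 12 ψ² dV +
6 ∫ g_S⁻¹(dψ,dψ) dV` and `Vol(h) = ∫ ψ⁴ dV` (`totalScalarCurvature_conformal_sq`,
`scalarCurvature_roundMetric`), so the claim is (⋆) for this `ψ`.
[cite: Aubin1982, Thm. 6.12] [cite: Aubin1982, Ch. 6, §6.4, Prop.] -/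
theorem yamabe_roundMetric_sphere_four_of_sharpSobolev
    (hS : ∀ ψ : sphere (0 : EuclideanSpace ℝ (Fin 5)) 1 → ℝ,
      ContMDiff (𝓡 4) 𝓘(ℝ) ∞ ψ → (∀ x, 0 < ψ x) →
      8 * Real.sqrt 6 * Real.pi *
          Real.sqrt (∫ x, ψ x ^ 4
            ∂(riemannianMeasure ((roundMetric (n := 4) (EuclideanSpace ℝ (Fin 5)))
              |>.toContMDiffRiemannianMetric isRiemannian_roundMetric))) ≤
        12 * ∫ x, ψ x ^ 2
            ∂(riemannianMeasure ((roundMetric (n := 4) (EuclideanSpace ℝ (Fin 5)))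
              |>.toContMDiffRiemannianMetric isRiemannian_roundMetric)) +
          6 * ∫ x, (roundMetric (n := 4) (EuclideanSpace ℝ (Fin 5))).innerDual x
              (mvfderiv (𝓡 4) ψ x).toLinearMap (mvfderiv (𝓡 4) ψ x).toLinearMap
            ∂(riemannianMeasure ((roundMetric (n := 4) (EuclideanSpace ℝ (Fin 5)))
              |>.toContMDiffRiemannianMetric isRiemannian_roundMetric))) :
    yamabe_roundMetric_sphere_four := by
  intro g₀ hg₀ h hLC hconf
  haveI : (roundMetric (n := 4) (EuclideanSpace ℝ (Fin 5))).HasLeviCivita :=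
    (roundMetric (n := 4) (EuclideanSpace ℝ (Fin 5))).hasLeviCivita
  -- `h = φ g₀ = φ g_S` with `φ > 0`
  obtain ⟨φ, hφ⟩ := hconf
  have hφpos : ∀ x, 0 < φ x := fun x ↦ (hφ x).1
  have hconf' : ∀ (x : sphere (0 : EuclideanSpace ℝ (Fin 5)) 1) (v w : TangentSpace (𝓡 4) x),
      (ofRiemannian h).val x v w =
        φ x * (roundMetric (n := 4) (EuclideanSpace ℝ (Fin 5))).val x v w := by
    intro x v w
    rw [val_ofRiemannian, (hφ x).2 v w, hg₀ x v w, roundMetric_apply]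
  -- `φ` is smooth, `ψ = √φ` is smooth and positive, `h = ψ² g_S`
  have hφs : ContMDiff (𝓡 4) 𝓘(ℝ, ℝ) ∞ φ :=
    contMDiff_conformalFactor_one (roundMetric (n := 4) (EuclideanSpace ℝ (Fin 5))) (ofRiemannian h)
      isRiemannian_roundMetric hconf'
  set ψ : sphere (0 : EuclideanSpace ℝ (Fin 5)) 1 → ℝ := fun x ↦ Real.sqrt (φ x) with hψdef
  have hψpos : ∀ x, 0 < ψ x := fun x ↦ Real.sqrt_pos.2 (hφpos x)
  have hψsq : ∀ x, ψ x ^ 2 = φ x := fun x ↦ Real.sq_sqrt (hφpos x).le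
  have hψs : ContMDiff (𝓡 4) 𝓘(ℝ) ∞ ψ := fun x ↦
    (Real.contDiffAt_sqrt (hφpos x).ne').comp_contMDiffAt (hφs x)
  have hconfψ : ∀ (x : sphere (0 : EuclideanSpace ℝ (Fin 5)) 1) (v w : TangentSpace (𝓡 4) x),
      h.inner x v w = ψ x ^ 2 * (roundMetric (n := 4) (EuclideanSpace ℝ (Fin 5))).val x v w := by
    intro x v w
    rw [hψsq, ← val_ofRiemannian]
    exact hconf' x v w
  -- the conformal laws: `∫ R_h dV_h = ∫ R_S ψ² dV + 6 ∫ |dψ|² dV`, `Vol(h) = ∫ ψ⁴ dV`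
  obtain ⟨hT, hV⟩ :=
    totalScalarCurvature_conformal_sq (roundMetric (n := 4) (EuclideanSpace ℝ (Fin 5)))
      isRiemannian_roundMetric h hψs hψpos hconfψ
  set μ : Measure (sphere (0 : EuclideanSpace ℝ (Fin 5)) 1) :=
    riemannianMeasure ((roundMetric (n := 4) (EuclideanSpace ℝ (Fin 5)))
      |>.toContMDiffRiemannianMetric isRiemannian_roundMetric) with hμ
  -- `R_S = 12`, so `∫ R_S ψ² dV = 12 ∫ ψ² dV`
  have hR : ∀ x, (roundMetric (n := 4) (EuclideanSpace ℝ (Fin 5))).scalarCurvature x * ψ x ^ 2 =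
      12 * ψ x ^ 2 := by
    intro x
    rw [scalarCurvature_roundMetric (EuclideanSpace ℝ (Fin 5)) x]
    norm_num
  have h12 : ∫ x, (roundMetric (n := 4) (EuclideanSpace ℝ (Fin 5))).scalarCurvature x * ψ x ^ 2 ∂μ =
      12 * ∫ x, ψ x ^ 2 ∂μ := by
    rw [← integral_const_mul]
    exact integral_congr_ae (Filter.Eventually.of_forall hR)
  -- `∫ R_h dV_h = 12 ∫ ψ² dV + 6 ∫ g_S⁻¹(dψ,dψ) dV`
  have hT' : ∫ x, (ofRiemannian h).scalarCurvature x ∂(riemannianMeasure h) =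
      12 * ∫ x, ψ x ^ 2 ∂μ +
        6 * ∫ x, (roundMetric (n := 4) (EuclideanSpace ℝ (Fin 5))).innerDual x
          (mvfderiv (𝓡 4) ψ x).toLinearMap (mvfderiv (𝓡 4) ψ x).toLinearMap ∂μ := by
    rw [← h12]
    exact hT
  -- conclusion: the claim is (⋆) for `ψ`
  rw [hV, hT']
  exact hS ψ hψs hψpos

set_option synthInstance.maxHeartbeats 400000 in
set_option maxHeartbeats 800000 in
/-- **Conversely, the metric form gives back the function form**: `yamabe_roundMetric_sphere_four`
implies the sharp Sobolev inequality (⋆) for every smooth positive `ψ` on `S⁴` — apply the fact to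
`g₀ = g_S` (as a Mathlib Riemannian metric, `toContMDiffRiemannianMetric`; it satisfies
`g₀(v,w) = ⟪dι v, dι w⟫` by `roundMetric_apply`) and to the conformal metric `h = ψ² g_S`
(smooth: `ContMDiff.smul_section`), and read `∫ R_h dV_h`, `Vol(h)` through
`totalScalarCurvature_conformal_sq` and `R_{g_S} = 12`. So the named fact is EXACTLY Aubin's
(11) / Beckner's Thm. 4 on `S⁴` for smooth positive functions (Aubin 1982, Thm. 6.12 iii):
"Writing `μ = n(n−1)ω_n^{2/n}` yields (11)"). (Instance search on the fibres of `TS⁴` is slow,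
whence the raised heartbeat limits.) [cite: Aubin1982, Thm. 6.12] -/
theorem sharpSobolev_of_yamabe_roundMetric_sphere_four (hY : yamabe_roundMetric_sphere_four)
    (ψ : sphere (0 : EuclideanSpace ℝ (Fin 5)) 1 → ℝ) (hψs : ContMDiff (𝓡 4) 𝓘(ℝ) ∞ ψ)
    (hψpos : ∀ x, 0 < ψ x) :
    8 * Real.sqrt 6 * Real.pi *
        Real.sqrt (∫ x, ψ x ^ 4
          ∂(riemannianMeasure ((roundMetric (n := 4) (EuclideanSpace ℝ (Fin 5)))
            |>.toContMDiffRiemannianMetric isRiemannian_roundMetric))) ≤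
      12 * ∫ x, ψ x ^ 2
          ∂(riemannianMeasure ((roundMetric (n := 4) (EuclideanSpace ℝ (Fin 5)))
            |>.toContMDiffRiemannianMetric isRiemannian_roundMetric)) +
        6 * ∫ x, (roundMetric (n := 4) (EuclideanSpace ℝ (Fin 5))).innerDual x
            (mvfderiv (𝓡 4) ψ x).toLinearMap (mvfderiv (𝓡 4) ψ x).toLinearMap
          ∂(riemannianMeasure ((roundMetric (n := 4) (EuclideanSpace ℝ (Fin 5)))
            |>.toContMDiffRiemannianMetric isRiemannian_roundMetric)) := by
  haveI : (roundMetric (n := 4) (EuclideanSpace ℝ (Fin 5))).HasLeviCivita :=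
    (roundMetric (n := 4) (EuclideanSpace ℝ (Fin 5))).hasLeviCivita
  -- the round metric as a Mathlib Riemannian metric `g₀`, and the conformal metric `h = ψ² g₀`
  set g₀ : ContMDiffRiemannianMetric (𝓡 4) ∞ (EuclideanSpace ℝ (Fin 4))
      (TangentSpace (𝓡 4) : sphere (0 : EuclideanSpace ℝ (Fin 5)) 1 → Type _) :=
    (roundMetric (n := 4) (EuclideanSpace ℝ (Fin 5))).toContMDiffRiemannianMetric
      isRiemannian_roundMetric with hg₀
  have hψ2 : ContMDiff (𝓡 4) 𝓘(ℝ) ∞ (fun x ↦ ψ x ^ 2) := (contDiff_id.pow 2).comp_contMDiff hψs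
  let h : ContMDiffRiemannianMetric (𝓡 4) ∞ (EuclideanSpace ℝ (Fin 4))
      (TangentSpace (𝓡 4) : sphere (0 : EuclideanSpace ℝ (Fin 5)) 1 → Type _) :=
    { inner := fun x ↦ (ψ x ^ 2) • g₀.inner x
      symm := fun x v w ↦ by
        change ψ x ^ 2 * g₀.inner x v w = ψ x ^ 2 * g₀.inner x w v
        rw [g₀.symm x v w]
      pos := fun x v hv ↦ by
        change 0 < ψ x ^ 2 * g₀.inner x v v
        exact mul_pos (pow_pos (hψpos x) 2) (g₀.pos x v hv)
      isVonNBounded := fun x ↦ by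
        refine PseudoRiemannianMetric.IsSpacelikeImmersion.isVonNBounded_setOf_lt_one_of_pos
          (V := EuclideanSpace ℝ (Fin 4)) ((ψ x ^ 2) • g₀.inner x) fun v hv ↦ ?_
        change 0 < ψ x ^ 2 * g₀.inner x v v
        exact mul_pos (pow_pos (hψpos x) 2) (g₀.pos x v hv)
      contMDiff := by exact hψ2.smul_section g₀.contMDiff }
  haveI hLC : (ofRiemannian h).HasLeviCivita := (ofRiemannian h).hasLeviCivita
  -- `g₀` is the round metric in the sense of the fact, and `h ∈ [g₀]`
  have hround : ∀ (y : sphere (0 : EuclideanSpace ℝ (Fin 5)) 1) (v w : TangentSpace (𝓡 4) y),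
      g₀.inner y v w =
        inner ℝ
          (mfderiv (𝓡 4) 𝓘(ℝ, EuclideanSpace ℝ (Fin 5))
            ((↑) : sphere (0 : EuclideanSpace ℝ (Fin 5)) 1 → EuclideanSpace ℝ (Fin 5)) y v :
            EuclideanSpace ℝ (Fin 5))
          (mfderiv (𝓡 4) 𝓘(ℝ, EuclideanSpace ℝ (Fin 5))
            ((↑) : sphere (0 : EuclideanSpace ℝ (Fin 5)) 1 → EuclideanSpace ℝ (Fin 5)) y w :
            EuclideanSpace ℝ (Fin 5)) := by
    intro y v w
    rw [hg₀, toContMDiffRiemannianMetric_inner, roundMetric_apply]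
  have hconf : IsConformalTo h g₀ :=
    ⟨fun x ↦ ψ x ^ 2, fun x ↦ ⟨pow_pos (hψpos x) 2, fun v w ↦ rfl⟩⟩
  have hconfψ : ∀ (x : sphere (0 : EuclideanSpace ℝ (Fin 5)) 1) (v w : TangentSpace (𝓡 4) x),
      h.inner x v w = ψ x ^ 2 * (roundMetric (n := 4) (EuclideanSpace ℝ (Fin 5))).val x v w :=
    fun x v w ↦ rfl
  -- the fact, for `g₀` and `h`
  have key := hY g₀ hround h hconf
  -- read through the conformal laws and `R_S = 12`
  obtain ⟨hT, hV⟩ :=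
    totalScalarCurvature_conformal_sq (roundMetric (n := 4) (EuclideanSpace ℝ (Fin 5)))
      isRiemannian_roundMetric h hψs hψpos hconfψ
  set μ : Measure (sphere (0 : EuclideanSpace ℝ (Fin 5)) 1) :=
    riemannianMeasure ((roundMetric (n := 4) (EuclideanSpace ℝ (Fin 5)))
      |>.toContMDiffRiemannianMetric isRiemannian_roundMetric) with hμ
  have hR : ∀ x, (roundMetric (n := 4) (EuclideanSpace ℝ (Fin 5))).scalarCurvature x * ψ x ^ 2 =
      12 * ψ x ^ 2 := by
    intro x
    rw [scalarCurvature_roundMetric (EuclideanSpace ℝ (Fin 5)) x]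
    norm_num
  have h12 : ∫ x, (roundMetric (n := 4) (EuclideanSpace ℝ (Fin 5))).scalarCurvature x * ψ x ^ 2 ∂μ =
      12 * ∫ x, ψ x ^ 2 ∂μ := by
    rw [← integral_const_mul]
    exact integral_congr_ae (Filter.Eventually.of_forall hR)
  have hT' : ∫ x, (ofRiemannian h).scalarCurvature x ∂(riemannianMeasure h) =
      12 * ∫ x, ψ x ^ 2 ∂μ +
        6 * ∫ x, (roundMetric (n := 4) (EuclideanSpace ℝ (Fin 5))).innerDual x
          (mvfderiv (𝓡 4) ψ x).toLinearMap (mvfderiv (𝓡 4) ψ x).toLinearMap ∂μ := by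
    rw [← h12]
    exact hT
  rw [hV, hT'] at key
  exact key

/-- Hence the named fact `yamabe_roundMetric_sphere_four` (Aubin 1982, Thm. 6.12, metric form on
`S⁴`) is EQUIVALENT to the sharp Sobolev inequality (⋆) on the round `S⁴` for smooth positive
functions (its function form, loc. cit. (11); Beckner 1993, Thm. 4). [cite: Aubin1982, Thm. 6.12] -/
theorem yamabe_roundMetric_sphere_four_iff_sharpSobolev :
    yamabe_roundMetric_sphere_four ↔
      ∀ ψ : sphere (0 : EuclideanSpace ℝ (Fin 5)) 1 → ℝ,
        ContMDiff (𝓡 4) 𝓘(ℝ) ∞ ψ → (∀ x, 0 < ψ x) →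
        8 * Real.sqrt 6 * Real.pi *
            Real.sqrt (∫ x, ψ x ^ 4
              ∂(riemannianMeasure ((roundMetric (n := 4) (EuclideanSpace ℝ (Fin 5)))
                |>.toContMDiffRiemannianMetric isRiemannian_roundMetric))) ≤
          12 * ∫ x, ψ x ^ 2
              ∂(riemannianMeasure ((roundMetric (n := 4) (EuclideanSpace ℝ (Fin 5)))
                |>.toContMDiffRiemannianMetric isRiemannian_roundMetric)) +
            6 * ∫ x, (roundMetric (n := 4) (EuclideanSpace ℝ (Fin 5))).innerDual x
                (mvfderiv (𝓡 4) ψ x).toLinearMap (mvfderiv (𝓡 4) ψ x).toLinearMap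
              ∂(riemannianMeasure ((roundMetric (n := 4) (EuclideanSpace ℝ (Fin 5)))
                |>.toContMDiffRiemannianMetric isRiemannian_roundMetric)) :=
  ⟨sharpSobolev_of_yamabe_roundMetric_sphere_four, yamabe_roundMetric_sphere_four_of_sharpSobolev⟩

/-! ### The round metric attains the bound: `Q(g_S) = 8√6 π`; hence `Y(S⁴,[g_S]) = 8√6 π` -/

/-- **`∫_{S⁴} R_{g_S} dV = 32π²`**: the total scalar curvature of the round unit `4`-sphere
(`R_{g_S} = 12`, `scalarCurvature_roundMetric`; `Vol(S⁴) = 8π²/3`,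
`riemannianMeasure_roundMetric_sphere_four_univ`), for the round metric as a Mathlib Riemannian
metric and any (the) Levi-Civita instance. Read through `totalScalarCurvature_conformal_sq` with
`ψ ≡ 1` (`d1 = 0`). [cite: Aubin1982, Thm. 6.12] -/
theorem totalScalarCurvature_roundMetric_sphere_four
    [(ofRiemannian ((roundMetric (n := 4) (EuclideanSpace ℝ (Fin 5)))
      |>.toContMDiffRiemannianMetric isRiemannian_roundMetric)).HasLeviCivita] :
    totalScalarCurvature ((roundMetric (n := 4) (EuclideanSpace ℝ (Fin 5)))
        |>.toContMDiffRiemannianMetric isRiemannian_roundMetric) =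
      32 * Real.pi ^ 2 := by
  haveI : (roundMetric (n := 4) (EuclideanSpace ℝ (Fin 5))).HasLeviCivita :=
    (roundMetric (n := 4) (EuclideanSpace ℝ (Fin 5))).hasLeviCivita
  obtain ⟨hT, -⟩ :=
    totalScalarCurvature_conformal_sq (roundMetric (n := 4) (EuclideanSpace ℝ (Fin 5)))
      isRiemannian_roundMetric
      ((roundMetric (n := 4) (EuclideanSpace ℝ (Fin 5))).toContMDiffRiemannianMetric
        isRiemannian_roundMetric)
      (ψ := fun _ ↦ (1 : ℝ)) contMDiff_const (fun _ ↦ one_pos)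
      (fun x v w ↦ by rw [one_pow, one_mul, toContMDiffRiemannianMetric_inner])
  rw [hT]
  have hR : ∀ x : sphere (0 : EuclideanSpace ℝ (Fin 5)) 1,
      (roundMetric (n := 4) (EuclideanSpace ℝ (Fin 5))).scalarCurvature x * (1 : ℝ) ^ 2 = 12 := by
    intro x
    rw [scalarCurvature_roundMetric (EuclideanSpace ℝ (Fin 5)) x]
    norm_num
  have hgrad : ∀ x : sphere (0 : EuclideanSpace ℝ (Fin 5)) 1,
      (roundMetric (n := 4) (EuclideanSpace ℝ (Fin 5))).innerDual x
        (mvfderiv (𝓡 4) (fun _ : sphere (0 : EuclideanSpace ℝ (Fin 5)) 1 ↦ (1 : ℝ)) x).toLinearMap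
        (mvfderiv (𝓡 4) (fun _ : sphere (0 : EuclideanSpace ℝ (Fin 5)) 1 ↦ (1 : ℝ)) x).toLinearMap =
        0 := by
    intro x
    rw [mvfderiv_const]
    simp [PseudoRiemannianMetric.innerDual]
  rw [show (fun x : sphere (0 : EuclideanSpace ℝ (Fin 5)) 1 ↦
      (roundMetric (n := 4) (EuclideanSpace ℝ (Fin 5))).scalarCurvature x * (1 : ℝ) ^ 2) =
      fun _ ↦ (12 : ℝ) from funext hR,
    show (fun x : sphere (0 : EuclideanSpace ℝ (Fin 5)) 1 ↦
      (roundMetric (n := 4) (EuclideanSpace ℝ (Fin 5))).innerDual x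
        (mvfderiv (𝓡 4) (fun _ : sphere (0 : EuclideanSpace ℝ (Fin 5)) 1 ↦ (1 : ℝ)) x).toLinearMap
        (mvfderiv (𝓡 4) (fun _ : sphere (0 : EuclideanSpace ℝ (Fin 5)) 1 ↦ (1 : ℝ))
          x).toLinearMap) =
      fun _ ↦ (0 : ℝ) from funext hgrad,
    integral_const, integral_zero, mul_zero, add_zero, smul_eq_mul, measureReal_def,
    toReal_riemannianMeasure_roundMetric_sphere_four_univ]
  ring

/-- **The round metric attains the bound of `yamabe_roundMetric_sphere_four`:
`Q(g_S) = (∫ R_{g_S} dV)/Vol(S⁴,g_S)^{1/2} = 32π²/(8π²/3)^{1/2} = 8√6 π`** (Aubin 1982, Thm. 6.12: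
on `S_n`, `μ = n(n−1)ω_n^{2/n} = J(1)`; `n = 4`: `12 ω₄^{1/2} = 8√6 π`). In particular the
constant `8√6 π` in the fact (and in (⋆)) is sharp. [cite: Aubin1982, Thm. 6.12] -/
theorem yamabeQuotient_roundMetric_sphere_four
    [(ofRiemannian ((roundMetric (n := 4) (EuclideanSpace ℝ (Fin 5)))
      |>.toContMDiffRiemannianMetric isRiemannian_roundMetric)).HasLeviCivita] :
    yamabeQuotient ((roundMetric (n := 4) (EuclideanSpace ℝ (Fin 5)))
        |>.toContMDiffRiemannianMetric isRiemannian_roundMetric) =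
      8 * Real.sqrt 6 * Real.pi := by
  have hE : finrank ℝ (EuclideanSpace ℝ (Fin 4)) = 4 := finrank_euclideanSpace_fin
  rw [yamabeQuotient_eq_div_sqrt hE, totalScalarCurvature_roundMetric_sphere_four,
    toReal_riemannianMeasure_roundMetric_sphere_four_univ]
  have h6 : Real.sqrt 6 ^ 2 = 6 := Real.sq_sqrt (by norm_num)
  have hs : Real.sqrt (8 * Real.pi ^ 2 / 3) = 2 * Real.pi * Real.sqrt 6 / 3 := by
    rw [show 8 * Real.pi ^ 2 / 3 = (2 * Real.pi * Real.sqrt 6 / 3) ^ 2 by nlinarith [h6],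
      Real.sqrt_sq (by positivity)]
  rw [hs, div_eq_iff (by positivity)]
  nlinarith [h6, Real.pi_pos]

/-- **`Y(S⁴,[g_S]) = 8√6 π`, given the fact** (Aubin 1982, Thm. 6.12, `n = 4`; the
normalisation `Y(S⁴,[g_S]) = 8√6 π ≈ 61.56` of Chang–Gursky–Yang 2003 and Li–Qing–Shi 2017): the
fact `yamabe_roundMetric_sphere_four` bounds every quotient of the round class from below by
`8√6 π` (`le_yamabeConstant_of_forall_mul_sqrt_le`; volumes of metrics on the closed `S⁴` are
positive and finite), and the round metric itself has quotient `8√6 π`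
(`yamabeQuotient_roundMetric_sphere_four`, `yamabeConstant_le_of_le`).
[cite: Aubin1982, Thm. 6.12] [cite: ChangGurskyYang2003, Remark 1] -/
theorem yamabeConstant_roundMetric_sphere_four (hY : yamabe_roundMetric_sphere_four)
    [(ofRiemannian ((roundMetric (n := 4) (EuclideanSpace ℝ (Fin 5)))
      |>.toContMDiffRiemannianMetric isRiemannian_roundMetric)).HasLeviCivita] :
    yamabeConstant ((roundMetric (n := 4) (EuclideanSpace ℝ (Fin 5)))
        |>.toContMDiffRiemannianMetric isRiemannian_roundMetric) =
      8 * Real.sqrt 6 * Real.pi := by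
  have hE : finrank ℝ (EuclideanSpace ℝ (Fin 4)) = 4 := finrank_euclideanSpace_fin
  set g₀ : ContMDiffRiemannianMetric (𝓡 4) ∞ (EuclideanSpace ℝ (Fin 4))
      (TangentSpace (𝓡 4) : sphere (0 : EuclideanSpace ℝ (Fin 5)) 1 → Type _) :=
    (roundMetric (n := 4) (EuclideanSpace ℝ (Fin 5))).toContMDiffRiemannianMetric
      isRiemannian_roundMetric with hg₀
  -- `g₀` is the round metric in the sense of the fact
  have hround : ∀ (y : sphere (0 : EuclideanSpace ℝ (Fin 5)) 1) (v w : TangentSpace (𝓡 4) y),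
      g₀.inner y v w =
        inner ℝ
          (mfderiv (𝓡 4) 𝓘(ℝ, EuclideanSpace ℝ (Fin 5))
            ((↑) : sphere (0 : EuclideanSpace ℝ (Fin 5)) 1 → EuclideanSpace ℝ (Fin 5)) y v :
            EuclideanSpace ℝ (Fin 5))
          (mfderiv (𝓡 4) 𝓘(ℝ, EuclideanSpace ℝ (Fin 5))
            ((↑) : sphere (0 : EuclideanSpace ℝ (Fin 5)) 1 → EuclideanSpace ℝ (Fin 5)) y w :
            EuclideanSpace ℝ (Fin 5)) := by
    intro y v w
    rw [hg₀, toContMDiffRiemannianMetric_inner, roundMetric_apply]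
  -- volumes of metrics on the closed `S⁴` are positive (and finite)
  have hvol : ∀ (h : ContMDiffRiemannianMetric (𝓡 4) ∞ (EuclideanSpace ℝ (Fin 4))
      (TangentSpace (𝓡 4) : sphere (0 : EuclideanSpace ℝ (Fin 5)) 1 → Type _)),
      0 < (riemannianMeasure h univ).toReal := by
    intro h
    haveI : Nonempty (sphere (0 : EuclideanSpace ℝ (Fin 5)) 1) :=
      (NormedSpace.sphere_nonempty.2 zero_le_one).to_subtype
    refine ENNReal.toReal_pos ?_ ?_
    · haveI := isOpenPosMeasure_riemannianMeasure (I := 𝓡 4) h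
      exact (isOpen_univ.measure_pos (riemannianMeasure h) univ_nonempty).ne'
    · exact (riemannianVolume_lt_top_of_isCompact_holds h le_rfl isCompact_univ).ne
  -- the fact: `8√6 π √Vol(h) ≤ ∫ R_h dV_h` for every `h ∈ [g₀]`
  have hlow : ∀ (h : ContMDiffRiemannianMetric (𝓡 4) ∞ (EuclideanSpace ℝ (Fin 4))
      (TangentSpace (𝓡 4) : sphere (0 : EuclideanSpace ℝ (Fin 5)) 1 → Type _))
      [(ofRiemannian h).HasLeviCivita], IsConformalTo h g₀ →
        8 * Real.sqrt 6 * Real.pi * Real.sqrt (riemannianMeasure h univ).toReal ≤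
          ∫ x, (ofRiemannian h).scalarCurvature x ∂(riemannianMeasure h) :=
    fun h _ hc ↦ hY g₀ hround h hc
  refine le_antisymm ?_ (le_yamabeConstant_of_forall_mul_sqrt_le hE (fun h _ ↦ hvol h) hlow)
  -- `Y ≤ Q(g₀) = 8√6 π`
  have hbdd : BddBelow (yamabeQuotients g₀) := by
    refine ⟨8 * Real.sqrt 6 * Real.pi, ?_⟩
    rintro q ⟨h, hLC, hc, rfl⟩
    exact (le_yamabeQuotient_iff_mul_sqrt_le hE h (hvol h) _).2 (hlow h hc)
  exact yamabeConstant_le_of_le hbdd g₀ (IsConformalTo.refl g₀)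
    (yamabeQuotient_roundMetric_sphere_four).le

/-- **The `S⁴` case of Aubin's inequality `aubin_yamabe_le_sphere_four` holds outright in the
round class** (sanity check of the sibling named fact, Aubin 1982, Thm. 6.7, on `M = S⁴`,
`g₀ = g_S`): for every `ε > 0` the round metric itself has
`∫ R_{g_S} dV = 32π² < (8√6 π + ε) √Vol(S⁴,g_S) = 32π² + (2π√6/3) ε`.
[cite: Aubin1982, Thm. 6.7] [cite: Aubin1982, Thm. 6.12] -/
theorem aubin_yamabe_le_sphere_four.roundMetric_sphere_four (ε : ℝ) (hε : 0 < ε) :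
    ∃ (h : ContMDiffRiemannianMetric (𝓡 4) ∞ (EuclideanSpace ℝ (Fin 4))
        (TangentSpace (𝓡 4) : sphere (0 : EuclideanSpace ℝ (Fin 5)) 1 → Type _))
      (_ : (ofRiemannian h).HasLeviCivita),
      IsConformalTo h ((roundMetric (n := 4) (EuclideanSpace ℝ (Fin 5)))
        |>.toContMDiffRiemannianMetric isRiemannian_roundMetric) ∧
      ∫ x, (ofRiemannian h).scalarCurvature x ∂(riemannianMeasure h) <
        (8 * Real.sqrt 6 * Real.pi + ε) * Real.sqrt (riemannianMeasure h univ).toReal := by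
  haveI hLC : (ofRiemannian ((roundMetric (n := 4) (EuclideanSpace ℝ (Fin 5)))
      |>.toContMDiffRiemannianMetric isRiemannian_roundMetric)).HasLeviCivita :=
    (ofRiemannian _).hasLeviCivita
  refine ⟨_, hLC, IsConformalTo.refl _, ?_⟩
  change totalScalarCurvature ((roundMetric (n := 4) (EuclideanSpace ℝ (Fin 5)))
      |>.toContMDiffRiemannianMetric isRiemannian_roundMetric) < _
  rw [totalScalarCurvature_roundMetric_sphere_four,
    toReal_riemannianMeasure_roundMetric_sphere_four_univ]
  have h6 : Real.sqrt 6 ^ 2 = 6 := Real.sq_sqrt (by norm_num)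
  have hs : Real.sqrt (8 * Real.pi ^ 2 / 3) = 2 * Real.pi * Real.sqrt 6 / 3 := by
    rw [show 8 * Real.pi ^ 2 / 3 = (2 * Real.pi * Real.sqrt 6 / 3) ^ 2 by nlinarith [h6],
      Real.sqrt_sq (by positivity)]
  rw [hs]
  have hsqrt6 : 0 < Real.sqrt 6 := Real.sqrt_pos.2 (by norm_num)
  nlinarith [h6, Real.pi_pos, mul_pos (mul_pos hε Real.pi_pos) hsqrt6]

/-- **The sharp Sobolev inequality (⋆) in Beckner's normalised form.** With `Vol(S⁴,g_S) = 8π²/3`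
(`RoundSphereVolume.lean`), (⋆) for smooth positive `ψ` is equivalent to the printed form of
Beckner 1993, Thm. 4 (`n = 4`, `q = 4`, `(q−2)/n = 1/2`; normalised measure `dσ = dV/Vol(S⁴)`):
`(⨍ ψ⁴ dσ)^{1/2} ≤ ⨍ ψ² dσ + ½ ⨍ |dψ|² dσ`, i.e. `‖ψ‖²_{L⁴(σ)} ≤ ‖ψ‖²_{L²(σ)} + ½ ‖∇ψ‖²_{L²(σ)}`
(equivalently Aubin 1982, Thm. 6.12 (11) on the sphere of volume `1`). Pure arithmetic:
`Vol^{-1/2} = √6/(4π)` and multiplication by `32π² = 12 Vol`.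
[cite: Beckner1993, Thm. 4] [cite: Aubin1982, Thm. 6.12] -/
theorem sharpSobolev_sphere_four_iff_normalised :
    (∀ ψ : sphere (0 : EuclideanSpace ℝ (Fin 5)) 1 → ℝ,
        ContMDiff (𝓡 4) 𝓘(ℝ) ∞ ψ → (∀ x, 0 < ψ x) →
        8 * Real.sqrt 6 * Real.pi *
            Real.sqrt (∫ x, ψ x ^ 4
              ∂(riemannianMeasure ((roundMetric (n := 4) (EuclideanSpace ℝ (Fin 5)))
                |>.toContMDiffRiemannianMetric isRiemannian_roundMetric))) ≤
          12 * ∫ x, ψ x ^ 2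
              ∂(riemannianMeasure ((roundMetric (n := 4) (EuclideanSpace ℝ (Fin 5)))
                |>.toContMDiffRiemannianMetric isRiemannian_roundMetric)) +
            6 * ∫ x, (roundMetric (n := 4) (EuclideanSpace ℝ (Fin 5))).innerDual x
                (mvfderiv (𝓡 4) ψ x).toLinearMap (mvfderiv (𝓡 4) ψ x).toLinearMap
              ∂(riemannianMeasure ((roundMetric (n := 4) (EuclideanSpace ℝ (Fin 5)))
                |>.toContMDiffRiemannianMetric isRiemannian_roundMetric))) ↔
    (∀ ψ : sphere (0 : EuclideanSpace ℝ (Fin 5)) 1 → ℝ,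
        ContMDiff (𝓡 4) 𝓘(ℝ) ∞ ψ → (∀ x, 0 < ψ x) →
        Real.sqrt ((riemannianMeasure ((roundMetric (n := 4) (EuclideanSpace ℝ (Fin 5)))
              |>.toContMDiffRiemannianMetric isRiemannian_roundMetric) univ).toReal⁻¹ *
            ∫ x, ψ x ^ 4
              ∂(riemannianMeasure ((roundMetric (n := 4) (EuclideanSpace ℝ (Fin 5)))
                |>.toContMDiffRiemannianMetric isRiemannian_roundMetric))) ≤
          (riemannianMeasure ((roundMetric (n := 4) (EuclideanSpace ℝ (Fin 5)))
              |>.toContMDiffRiemannianMetric isRiemannian_roundMetric) univ).toReal⁻¹ *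
            ∫ x, ψ x ^ 2
              ∂(riemannianMeasure ((roundMetric (n := 4) (EuclideanSpace ℝ (Fin 5)))
                |>.toContMDiffRiemannianMetric isRiemannian_roundMetric)) +
          1 / 2 * ((riemannianMeasure ((roundMetric (n := 4) (EuclideanSpace ℝ (Fin 5)))
              |>.toContMDiffRiemannianMetric isRiemannian_roundMetric) univ).toReal⁻¹ *
            ∫ x, (roundMetric (n := 4) (EuclideanSpace ℝ (Fin 5))).innerDual x
                (mvfderiv (𝓡 4) ψ x).toLinearMap (mvfderiv (𝓡 4) ψ x).toLinearMap
              ∂(riemannianMeasure ((roundMetric (n := 4) (EuclideanSpace ℝ (Fin 5)))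
                |>.toContMDiffRiemannianMetric isRiemannian_roundMetric)))) := by
  rw [toReal_riemannianMeasure_roundMetric_sphere_four_univ]
  -- the arithmetic, for `A = ∫ψ⁴ ≥ 0`, `B = ∫ψ²`, `C = ∫|dψ|²`
  have key : ∀ A B C : ℝ, 0 ≤ A →
      (8 * Real.sqrt 6 * Real.pi * Real.sqrt A ≤ 12 * B + 6 * C ↔
        Real.sqrt ((8 * Real.pi ^ 2 / 3)⁻¹ * A) ≤
          (8 * Real.pi ^ 2 / 3)⁻¹ * B + 1 / 2 * ((8 * Real.pi ^ 2 / 3)⁻¹ * C)) := by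
    intro A B C hA
    have hπ := Real.pi_pos
    have h6 : Real.sqrt 6 ^ 2 = 6 := Real.sq_sqrt (by norm_num)
    have hsV : Real.sqrt ((8 * Real.pi ^ 2 / 3)⁻¹) = Real.sqrt 6 / (4 * Real.pi) := by
      rw [show (8 * Real.pi ^ 2 / 3)⁻¹ = (Real.sqrt 6 / (4 * Real.pi)) ^ 2 by
        field_simp; nlinarith [h6], Real.sqrt_sq (by positivity)]
    rw [Real.sqrt_mul (by positivity), hsV]
    have hK : (0 : ℝ) < 32 * Real.pi ^ 2 := by positivity
    have e1 : Real.sqrt 6 / (4 * Real.pi) * Real.sqrt A * (32 * Real.pi ^ 2) =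
        8 * Real.sqrt 6 * Real.pi * Real.sqrt A := by
      field_simp
      ring
    have e2 : ((8 * Real.pi ^ 2 / 3)⁻¹ * B + 1 / 2 * ((8 * Real.pi ^ 2 / 3)⁻¹ * C)) *
        (32 * Real.pi ^ 2) = 12 * B + 6 * C := by
      field_simp
      ring
    rw [← e1, ← e2]
    exact mul_le_mul_iff_left₀ hK
  constructor
  · intro h ψ hψ hpos
    exact (key _ _ _ (integral_nonneg fun x ↦ by positivity)).1 (h ψ hψ hpos)
  · intro h ψ hψ hpos
    exact (key _ _ _ (integral_nonneg fun x ↦ by positivity)).2 (h ψ hψ hpos)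

end Literature.Geometry.Riemannian

end
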